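import Summits.QuantumFields.BalabanUV.T4Continuum.Support.SkeletonFillFullSmall

/-!
# T⁴ programme, node NE3 — kinematic refinement lemma, leaf R1c∕R1d (row NE3-S4d), file F3d: **THE SMALL-FIELD BOUND,
# UNITARITY AND PERIODICITY OF THE CLOSED-FORM FILLING** — three of the five fields of the R1 socket for `W := fullFill L T h`

Cell `pub-balaban`, NE3 formalisation swarm, unit `b2b-balaban-t4-ne3-formalise-leaf-07` (LEAF PROVER 07), row **S4d** of
`t4/formal/NE3/LEAVES.md`.  Assembles the four plaquette deviations of `SkeletonFillFullNorms` (cases I, II),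
`SkeletonFillFullFaces` (III) and `SkeletonFillFullSmall` (IV) into ONE radius.  SOCKET: the owner's `ApproxRefine`
(skeleton v1.2 (42S)) ∕ row R0's `hR1` (leaf-09, `SmoothRefineAssembly`) ask, for `W`, `IsUnitaryCfg W`, `IsPeriodicCfg W
(N·L^{j+1})`, `SmallField W (b₁∕(L^{j+1})²)`, a flux-gradient bound and the mismatch of the average; THIS FILE delivers the
first three for `W := fullFill L T h` in terms of the data's own constants: unitary `T, h` ⇒ `W` unitary; `P`-periodic
`T, h` ⇒ `W` `(L·P)`-periodic; roots within `a₀` of `1`, covariant root gradients `≤ δ`, root identity `h^{L²} = T(∂p)` ⇒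
**`SmallField W (a₀ + 2d(L−1)δ + 2d(L−1)Lδ + 8S²)`**, `S = d(L−1)a₀ + d(L−1)La₀ + L²a₀` — «the root radius, plus a covariant
root GRADIENT, plus second order»: no term linear in `a₀` beyond the root radius itself.  The translation `a₀ ≈ F∕L²`,
`δ ≈ ∇F∕L²` from `RegularSup b c j U` through row S4c's `T := exp(−X₀)U`, `h := T(∂p)^{1∕L²}` (`UnitaryRootInterpolation`)
and the flux-gradient ∕ mismatch fields are the R1 ASSEMBLY (rows R0 ∕ S4e), not this file.

CONTENT (all [folklore]; 0 sorry): `isUnitaryCfg_fullFill`, `isPeriodicCfg_fullFill`, `norm_plaq_lt_sub_one_le` (the four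
cases under one roof for `μ < ν`), **`smallField_fullFill`** (both orientations, via `hol_plaqWord_swap`).

HONEST FRAMING.  Norm bookkeeping for a kinematic construction; no minimiser, no conditional of the cell (`BetaPertH`, (B),
(B^μ)); nothing bears on infinite volume, a mass gap, or the Clay problem; **NE3 is NOT proved**; `SmoothRefine` ∕
`ApproxRefine` NOT proved (the flux-gradient field, the mismatch (S4e) and the assembly (R0) remain).  Finite T⁴ rung (B)+1.
ABSOLUTE RULE kept: no printed sentence is a hypothesis; no `def … : Prop` fact; no `sorry`, axioms ⊆ {propext,
Classical.choice, Quot.sound}.  PLACEMENT (human rule 2026-08-19): under `Summits/QuantumFields/BalabanUV/`; imports F3c only.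
-/

set_option autoImplicit false

open scoped BigOperators Matrix Matrix.Norms.L2Operator
open NormedSpace

namespace Summit.QuantumFields.BalabanUV.T4Continuum.SkeletonFillFullSmallField

open Literature.MathematicalPhysics.QuantumFieldTheory.Balaban1983to89
open B7Prop1Explicit B7Prop2Explicit B7Prop1Local MatrixLog UnitaryModel
open T4AveragingDeficitWall hiding Site Plane Plaq Bond
open T4AveragingDeficitWallBoundary (IsPeriodicCfg)
open AveragingDeficitTransport AveragingDeficitNearIdentity GaugeFieldPerturbation
open SkeletonLattice SkeletonFill SkeletonFillFull SkeletonFillFullNorms SkeletonFillFullFaces SkeletonFillFullSmall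

noncomputable section

variable {d : ℕ} {n : Type*} [Fintype n] [DecidableEq n]

/-- **THE FILLING IS UNITARY** for unitary data. [folklore] -/
theorem isUnitaryCfg_fullFill {L : ℕ} {T : Site d → Fin d → (Matrix n n ℂ)ˣ} {h : Site d → Fin d → Fin d → (Matrix n n ℂ)ˣ}
    (hT : ∀ (z : Site d) (κ : Fin d), T z κ ∈ unitaryUnits (Matrix n n ℂ))
    (hh : ∀ (z : Site d) (κ ν : Fin d), h z κ ν ∈ unitaryUnits (Matrix n n ℂ)) : IsUnitaryCfg (fullFill L T h) :=
  fun x μ => fullFill_mem hT hh x μ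

/-- **THE FILLING IS `(L·P)`-PERIODIC** for `P`-periodic data (`L ≥ 1`). [folklore] -/
theorem isPeriodicCfg_fullFill {L : ℕ} (hL : 1 ≤ L) {T : Site d → Fin d → (Matrix n n ℂ)ˣ}
    {h : Site d → Fin d → Fin d → (Matrix n n ℂ)ˣ} {P : ℤ} (hT : ∀ (z : Site d) (κ μ : Fin d), T (z + P • e κ) μ = T z μ)
    (hh : ∀ (z : Site d) (κ μ ν : Fin d), h (z + P • e κ) μ ν = h z μ ν) :
    IsPeriodicCfg (fullFill L T h) ((L : ℤ) * P) :=
  fun x κ μ => fullFill_add_period hL hT hh x κ μ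

section Small

variable [Nonempty n] {L : ℕ} {a₀ δ : ℝ}

/-- **THE FOUR CASES UNDER ONE ROOF** (`μ < ν`): every fine plaquette of the filling is within
`a₀ + 2d(L−1)δ + 2d(L−1)Lδ + 8S²` of `1`, `S = d(L−1)a₀ + d(L−1)La₀ + L²a₀`. [folklore] -/
theorem norm_plaq_lt_sub_one_le (hL : 1 ≤ L) {T : Site d → Fin d → (Matrix n n ℂ)ˣ}
    {h : Site d → Fin d → Fin d → (Matrix n n ℂ)ˣ}
    (hT : ∀ (z : Site d) (κ : Fin d), T z κ ∈ unitaryUnits (Matrix n n ℂ))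
    (hh : ∀ (z : Site d) (κ ν : Fin d), h z κ ν ∈ unitaryUnits (Matrix n n ℂ))
    (ha : ∀ (z : Site d) (κ ν : Fin d), κ < ν → ‖((h z κ ν : (Matrix n n ℂ)ˣ) : Matrix n n ℂ) - 1‖ ≤ a₀) (ha0 : 0 ≤ a₀)
    (hδ : ∀ (z : Site d) (ρ κ ι : Fin d), κ < ι →
      ‖((T z ρ * h (z + e ρ) κ ι * (T z ρ)⁻¹ : (Matrix n n ℂ)ˣ) : Matrix n n ℂ) - ((h z κ ι : (Matrix n n ℂ)ˣ) : Matrix n n ℂ)‖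
        ≤ δ) (hδ0 : 0 ≤ δ)
    (hroot : ∀ (z : Site d) (κ ι : Fin d), κ < ι → (h z κ ι) ^ (L * L) = hol T z (plaqWord κ ι))
    (x : Site d) {μ ν : Fin d} (hμν : μ < ν) :
    ‖((hol (fullFill L T h) x (plaqWord μ ν) : (Matrix n n ℂ)ˣ) : Matrix n n ℂ) - 1‖
      ≤ a₀ + 2 * (d * ((L - 1 : ℕ) * δ)) + 2 * (d * (((L - 1 : ℕ) * L) * δ))
        + 8 * (d * ((L - 1 : ℕ) * a₀) + d * (((L - 1 : ℕ) * L) * a₀) + L * L * a₀) ^ 2 := by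
  set z := cdiv L x with hzdef
  set q := cmod L x with hqdef
  have hx : x = (L : ℤ) • z + q := (smul_cdiv_add_cmod L x).symm
  have hq : InBox L q := fun i => ⟨cmod_nonneg hL x i, cmod_lt hL x i⟩
  rw [hx]
  -- the common comparison constants
  set θ : ℝ := d * ((L - 1 : ℕ) * a₀) with hθdef
  set θL : ℝ := d * (((L - 1 : ℕ) * L) * a₀) with hθLdef
  set S : ℝ := θ + θL + L * L * a₀ with hSdef
  have hLr : (1 : ℝ) ≤ L := by exact_mod_cast hL
  have hL1r : ((L - 1 : ℕ) : ℝ) ≤ L := by exact_mod_cast Nat.sub_le L 1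
  have hθ0 : 0 ≤ θ := by positivity
  have hθL0 : 0 ≤ θL := by positivity
  have hLLa : 0 ≤ (L : ℝ) * L * a₀ := by positivity
  have hS0 : 0 ≤ S := by positivity
  have hLL1 : ((L - 1 : ℕ) : ℝ) ≤ L * L := hL1r.trans (by nlinarith)
  have hLL2 : (L : ℝ) ≤ L * L := by nlinarith
  have hLL3 : ((L - 1 : ℕ) : ℝ) * L ≤ L * L := mul_le_mul_of_nonneg_right hL1r (by positivity)
  have h1 : ((L - 1 : ℕ) : ℝ) * a₀ ≤ S := by
    have := mul_le_mul_of_nonneg_right hLL1 ha0; linarith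
  have h2 : (L : ℝ) * a₀ ≤ S := by
    have := mul_le_mul_of_nonneg_right hLL2 ha0; linarith
  have h3 : ((L - 1 : ℕ) : ℝ) * L * a₀ ≤ S := by
    have := mul_le_mul_of_nonneg_right hLL3 ha0; linarith
  have hδd : 0 ≤ (d : ℝ) * ((L - 1 : ℕ) * δ) := by positivity
  have hδdL : 0 ≤ (d : ℝ) * (((L - 1 : ℕ) * L) * δ) := by positivity
  have hqμ := (hq μ).2
  have hqν := (hq ν).2
  by_cases hμ : q μ = (L : ℤ) - 1
  · by_cases hν : q ν = (L : ℤ) - 1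
    · refine (norm_plaq_corner_sub_one_le hL hT hh ha ha0 (hδ z) hδ0 hq hμν (hroot z μ ν hμν) hμ hν).trans ?_
      change a₀ + (2 * (d * ((L - 1 : ℕ) * δ)) + 2 * (d * (((L - 1 : ℕ) * L) * δ)))
        + (2 * (θ + θL) * (θ + θL) + 2 * ((L - 1 : ℕ) * a₀) * (θ + θL) + 2 * (((L - 1 : ℕ) * L) * a₀) * (θ + 2 * θL))
        ≤ a₀ + 2 * (d * ((L - 1 : ℕ) * δ)) + 2 * (d * (((L - 1 : ℕ) * L) * δ)) + 8 * S ^ 2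
      nlinarith [mul_le_mul h1 (show θ + θL ≤ S by linarith) (by positivity) hS0,
        mul_le_mul h3 (show θ + 2 * θL ≤ 2 * S by linarith) (by positivity) hS0,
        mul_le_mul (show θ + θL ≤ S by linarith) (show θ + θL ≤ S by linarith) (by positivity) hS0]
    · have hν' : q ν < (L : ℤ) - 1 := lt_of_le_of_ne (by omega) hν
      refine (norm_plaq_farμ_sub_one_le hL hT hh ha ha0 (fun κ ι hκι => hδ z μ κ ι hκι) hδ0 hq hμν hμ hν').trans ?_
      change a₀ + 2 * θ * θ + 2 * θL * θ + d * ((L - 1 : ℕ) * δ)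
        ≤ a₀ + 2 * (d * ((L - 1 : ℕ) * δ)) + 2 * (d * (((L - 1 : ℕ) * L) * δ)) + 8 * S ^ 2
      nlinarith [mul_le_mul (show θ ≤ S by linarith) (show θ ≤ S by linarith) hθ0 hS0,
        mul_le_mul (show θL ≤ S by linarith) (show θ ≤ S by linarith) hθ0 hS0]
  · have hμ' : q μ < (L : ℤ) - 1 := lt_of_le_of_ne (by omega) hμ
    by_cases hν : q ν = (L : ℤ) - 1
    · refine (norm_plaq_farν_sub_one_le hL hT hh ha ha0 (fun κ ι hκι => hδ z ν κ ι hκι) hδ0 hq hμν hμ' hν).trans ?_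
      change a₀ + 2 * (θ + L * a₀) * (θ + θL) + d * ((L - 1 : ℕ) * δ)
        ≤ a₀ + 2 * (d * ((L - 1 : ℕ) * δ)) + 2 * (d * (((L - 1 : ℕ) * L) * δ)) + 8 * S ^ 2
      nlinarith [mul_le_mul (show θ + L * a₀ ≤ 2 * S by linarith) (show θ + θL ≤ S by linarith) (by positivity)
        (by positivity)]
    · have hν' : q ν < (L : ℤ) - 1 := lt_of_le_of_ne (by omega) hν
      refine (norm_plaq_inner_sub_one_le (T := T) hh ha ha0 hq hμν hμ' hν').trans ?_
      change a₀ + 2 * θ * θ ≤ a₀ + 2 * (d * ((L - 1 : ℕ) * δ)) + 2 * (d * (((L - 1 : ℕ) * L) * δ)) + 8 * S ^ 2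
      nlinarith [mul_le_mul (show θ ≤ S by linarith) (show θ ≤ S by linarith) hθ0 hS0]

/-- **THE SMALL-FIELD BOUND OF THE CLOSED-FORM FILLING** (both orientations of every fine plaquette of `ℤ^d`):
`SmallField (fullFill L T h) (a₀ + 2d(L−1)δ + 2d(L−1)Lδ + 8S²)`, `S = d(L−1)a₀ + d(L−1)La₀ + L²a₀`, for unitary data with
roots within `a₀` of `1`, covariant root gradients `≤ δ` and the root identity `h^{L²} = T(∂p)`. [folklore] -/
theorem smallField_fullFill (hL : 1 ≤ L) {T : Site d → Fin d → (Matrix n n ℂ)ˣ}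
    {h : Site d → Fin d → Fin d → (Matrix n n ℂ)ˣ}
    (hT : ∀ (z : Site d) (κ : Fin d), T z κ ∈ unitaryUnits (Matrix n n ℂ))
    (hh : ∀ (z : Site d) (κ ν : Fin d), h z κ ν ∈ unitaryUnits (Matrix n n ℂ))
    (ha : ∀ (z : Site d) (κ ν : Fin d), κ < ν → ‖((h z κ ν : (Matrix n n ℂ)ˣ) : Matrix n n ℂ) - 1‖ ≤ a₀) (ha0 : 0 ≤ a₀)
    (hδ : ∀ (z : Site d) (ρ κ ι : Fin d), κ < ι →
      ‖((T z ρ * h (z + e ρ) κ ι * (T z ρ)⁻¹ : (Matrix n n ℂ)ˣ) : Matrix n n ℂ) - ((h z κ ι : (Matrix n n ℂ)ˣ) : Matrix n n ℂ)‖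
        ≤ δ) (hδ0 : 0 ≤ δ)
    (hroot : ∀ (z : Site d) (κ ι : Fin d), κ < ι → (h z κ ι) ^ (L * L) = hol T z (plaqWord κ ι)) :
    SmallField (fullFill L T h)
      (a₀ + 2 * (d * ((L - 1 : ℕ) * δ)) + 2 * (d * (((L - 1 : ℕ) * L) * δ))
        + 8 * (d * ((L - 1 : ℕ) * a₀) + d * (((L - 1 : ℕ) * L) * a₀) + L * L * a₀) ^ 2) := by
  intro x κ κ' hne
  rcases lt_or_gt_of_ne hne with hlt | hgt
  · exact norm_plaq_lt_sub_one_le hL hT hh ha ha0 hδ hδ0 hroot x hlt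
  · rw [hol_plaqWord_swap (fullFill L T h) x κ' κ,
      norm_val_inv_sub_one (hol_mem_of (S := unitaryUnits (Matrix n n ℂ)) (fullFill_mem hT hh) _ _)]
    exact norm_plaq_lt_sub_one_le hL hT hh ha ha0 hδ hδ0 hroot x hgt

end Small

end

end Summit.QuantumFields.BalabanUV.T4Continuum.SkeletonFillFullSmallField
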